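import Summits.HubbardSuperconductivity.HubbardSuperconductivity.Theorems.BirComplexStableXY.Negative.WitnessTable
import Literature.MathematicalPhysics.QuantumFieldTheory.TorusChartCochains
import HarnessLib

/-!
# Crux `BirComplexStableXYR`, line `fat-gaussian-defect-calculus`: stub E2 `stub_pathCfg_const`

Registered stub (lead c8, wave 8, skeleton `Cruxes/BirComplexStableXYR/Lines/fat_gaussian_defect_calculus.lean`),
helper (`--supports`) for the crux
`Summit.HubbardSuperconductivity.HubbardSuperconductivity.Theses.BalabanIR.BirComplexStableXYR`:
**the window path configuration of a constant cochain.**  On the engine's torus `Λ L M = (Fin 2 → ZMod L) × ZMod M`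
with the space–time chart `TorusChart.piProdZMod 2 L M` (directions `0, 1` spatial, `2` temporal), the staircase
sum `P ω s w` inside the window with corner `s` — `w.1` edges in direction `0`, then `w.2.1` edges in direction `1`,
then `w.2.2` edges in direction `2` (the defining hypothesis `hP`) — of the CONSTANT real `1`-cochain `x i ↦ v i`
is `w.1 * v 0 + w.2.1 * v 1 + w.2.2 * v 2`, independent of the corner `s`.

Proof: rewrite with the defining hypothesis; on any charted torus a line sum of `k` edges of a constant cochain is
`k` times the edge value (`TorusChart.lineSum` is a `Finset.range k` sum of equal terms: `Finset.sum_const`,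
`Finset.card_range`, `nsmul_eq_mul`).  No definitions; sorry-free.
-/

set_option linter.dupNamespace false -- summit = problem name (single-conjunct summit), D-0017

namespace Summit.HubbardSuperconductivity.HubbardSuperconductivity.Theorems.FSUnfolding

open scoped BigOperators
open Literature.MathematicalPhysics.QuantumFieldTheory Literature.Probability.LatticeModels
open Summit.HubbardSuperconductivity.BirComplexStableXYNegative

/-- **A line sum of a constant cochain** (any charted torus).  The line sum of the constant `1`-cochain
`x j ↦ v j` along `n` edges in direction `i` (from any base point `y`) is `n * v i`. [folklore] -/
theorem hsc_lineSum_constCochain {Λ' : Type*} [AddCommGroup Λ'] {d : ℕ} (F : TorusChart Λ' d)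
    (v : Fin d → ℝ) (i : Fin d) (n : ℕ) (y : Λ') :
    F.lineSum (fun _ j => v j) i n y = (n : ℝ) * v i := by
  simp only [TorusChart.lineSum, Finset.sum_const, Finset.card_range, nsmul_eq_mul]

/-- **Stub E2 `stub_pathCfg_const` (registered signature, verbatim): window path configuration of a constant
cochain.**  The staircase sums of the constant `1`-cochain `x i ↦ v i` inside the window with corner `s` are
`w₁v₀ + w₂v₁ + w₃v₂` (a line sum of `k` equal edge values is `k` times the value) — independent of `s`.
(`hsc_lineSum_constCochain` three times after rewriting with the defining hypothesis of `P`.) [folklore] -/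
theorem stub_pathCfg_const :
    ∀ (r L M : ℕ) [NeZero L] [NeZero M]
      (P : (Λ L M → Fin 3 → ℝ) → Λ L M → W r → ℝ),
      (∀ (ω : Λ L M → Fin 3 → ℝ) (s : Λ L M) (w : W r), P ω s w =
        (TorusChart.piProdZMod 2 L M).lineSum ω 0 (w.1 : ℕ) s
          + (TorusChart.piProdZMod 2 L M).lineSum ω 1 (w.2.1 : ℕ) (s + (w.1 : ℕ) • (TorusChart.piProdZMod 2 L M).gen 0)
          + (TorusChart.piProdZMod 2 L M).lineSum ω 2 (w.2.2 : ℕ)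
            (s + (w.1 : ℕ) • (TorusChart.piProdZMod 2 L M).gen 0 + (w.2.1 : ℕ) • (TorusChart.piProdZMod 2 L M).gen 1)) →
      ∀ (v : Fin 3 → ℝ) (s : Λ L M) (w : W r),
        P (fun _ i => v i) s w = ((w.1 : ℕ) : ℝ) * v 0 + ((w.2.1 : ℕ) : ℝ) * v 1 + ((w.2.2 : ℕ) : ℝ) * v 2 := by
  intro r L M _ _ P hP v s w
  rw [hP, hsc_lineSum_constCochain, hsc_lineSum_constCochain, hsc_lineSum_constCochain]

end Summit.HubbardSuperconductivity.HubbardSuperconductivity.Theorems.FSUnfolding
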